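import Mathlib
import Literature.Analysis.FluidPDE.ElgindiWeightedIBP
import Literature.Analysis.FluidPDE.WeakGradientSlicing
import Summits.NavierStokesRegularity.NavierStokesRegularity.Theorems.EulerZoomLiouvillePowerGaugeEulerLiouvilleFrozenLambMember
import HarnessLib

/-!
# Crux `EulerZoomLiouville.PowerGaugeEulerLiouville` (stmt-NavierStokesRegularity-19832), stub `stub_nonSelfSimilarRest`:
# VORTICITY AFFINE IN TIME (`∂ₜ²ω = 0` in `𝒟'` on a past slab) ⇒ TRIVIAL

Helper file (theorems only; `--supports stmt-NavierStokesRegularity-19832`; def-free).  Hand leafhand-ns-eulerzoomliouville-10 g4; the KINEMATIC form of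
`…FrozenLambMember`: by the vorticity equation `∂ₜω = −curl(ω × u)`, «`∂ₜ²ω = 0`» IS «the curl of the Lamb vector is frozen», and the momentum identity
tested with `θ'(t)η(x)` (`AntiMember.momentum_tensor`) converts one into the other.  Generalises hand g3's frozen-vorticity stratum
(`…FrozenVorticityMember`: `∂ₜω = 0` in `𝒟'` ⇒ trivial) from constant to AFFINE time dependence.

* `AffineCurl.integral_mul_inner_curlPair_eq` — for ANY smooth time cutoff `κ` compactly supported in `(−∞,0)`:
  `∫∫ κ(t) ⟪u, (∂ₐg)c − (∂_c g)a⟫ = −∫∫ κ(t) g(x) (⟪H a, c⟫ − ⟪H c, a⟫)` (the weak-gradient identity tested with `κ(t)g(x)`; hand g3's computation for `κ = θ'`,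
  extracted for all `κ`).
* `Loc.ae_eq_zero_of_distributionallyAffineVorticityPast` — MEMBER LEVEL, every `ρ > 0`: `∫∫ θ''(t) ⟪u, (∂ₐg)c − (∂_c g)a⟫ = 0` for all
  `θ ∈ C_c^∞((−∞,T₁))`, tests `g`, vectors `a, c` (the weak vorticity is affine in time in `𝒟'`) ⇒ `u = 0` a.e.
* `Loc.ae_eq_zero_of_affineWeakGradientCurl` — the same on the weak gradient: `∫∫ θ''(t) g(x) (⟪H a, c⟫ − ⟪H c, a⟫) = 0`.
* `Loc.ae_eq_zero_of_aeAffineWeakVorticity` — A.E. FORM: `⟪H(t,x)a, c⟫ − ⟪H(t,x)c, a⟫ = [W₀(x) + t W₁(x)]ₐ꜀ − [W₀(x) + t W₁(x)]꜀ₐ` for a.e. `(t,x) ∈ (−∞,T₁) × ℝ³`,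
  `W₀, W₁ ∈ L¹_loc` time-independent (`ω = ω₀ + t ω₁`) ⇒ trivial (Fubini, `∫ θ'' = 0`, `∫ t θ''(t) dt = 0`).
* Binder language `Birth.nonSelfSimilar_of_distributionallyAffineVorticityPast` / `Birth.nonSelfSimilar_of_aeAffineWeakVorticity`.

WHAT THIS IS NOT: not a proof of the stub or of the crux; nothing about Navier–Stokes. [folklore; MajdaBertozziCUP2002 §1.2, §2.4]
-/

noncomputable section

-- flat `Theorems/<Route><Decl>…` files of one crux share the namespace of the crux (tree convention)
set_option linter.dupNamespace false

open MeasureTheory Set Filter Topology Metric Function TopologicalSpace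
open scoped RealInnerProductSpace NNReal ENNReal ContDiff

namespace Summit.NavierStokesRegularity.NavierStokesRegularity.Theorems.PowerGaugeEulerLiouville

open Literature.Analysis Literature.Analysis.FunctionSpaces Literature.Analysis.FluidPDE

namespace AffineCurl

variable {u : ℝ → EuclideanSpace ℝ (Fin 3) → EuclideanSpace ℝ (Fin 3)}
  {H : ℝ → EuclideanSpace ℝ (Fin 3) → EuclideanSpace ℝ (Fin 3) →L[ℝ] EuclideanSpace ℝ (Fin 3)}

/-- **THE WEAK-GRADIENT IDENTITY TESTED WITH `κ(t) g(x)`**: for a field `u` with weak spatial gradient `H` on the slab `(−∞,0) × ℝ³`, a smooth time cutoff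
`κ` compactly supported in `(−∞,0)`, a scalar test `g` and vectors `a, c`,
`∫∫ κ(t) ⟪u, (∂ₐg)c − (∂_c g)a⟫ = −∫ dt ∫ dx κ(t) g(x) (⟪H a, c⟫ − ⟪H c, a⟫)`. [folklore] -/
theorem integral_mul_inner_curlPair_eq
    (hH : HasWeakSpatialGradientOn (slab (EuclideanSpace ℝ (Fin 3)) (Iio 0) isOpen_Iio) u H)
    {κ : ℝ → ℝ} (hκs : ContDiff ℝ ∞ κ) (hκc : HasCompactSupport κ) (hκT : tsupport κ ⊆ Iio 0)
    {g : EuclideanSpace ℝ (Fin 3) → ℝ} (hg : IsTestFunctionOn (⊤ : Opens (EuclideanSpace ℝ (Fin 3))) g) (a c' : EuclideanSpace ℝ (Fin 3)) :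
    ∫ z : ℝ × EuclideanSpace ℝ (Fin 3), κ z.1 * ⟪u z.1 z.2, fderiv ℝ g z.2 a • c' - fderiv ℝ g z.2 c' • a⟫ =
      -∫ t, ∫ x, κ t * g x * (⟪H t x a, c'⟫ - ⟪H t x c', a⟫) := by
  -- adapted from Theorems/EulerZoomLiouvillePowerGaugeEulerLiouvilleFrozenVorticityMember.lean (`Loc.ae_eq_zero_of_frozenWeakGradientCurl`, hand g3)
  have hκ : Continuous κ := hκs.continuous
  have hg' : IsTestFunctionOn (⟨univ, isOpen_univ⟩ : Opens (EuclideanSpace ℝ (Fin 3))) g :=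
    ⟨hg.contDiff, hg.hasCompactSupport, fun _ _ => trivial⟩
  have hΘ : IsSpaceTimeTestOn (slab (EuclideanSpace ℝ (Fin 3)) (Iio 0) isOpen_Iio) (fun t x => κ t • g x) :=
    isSpaceTimeTestOn_prod_smul isOpen_Iio isOpen_univ hκs hκc hκT hg'
  have hgd : Differentiable ℝ g := hg.contDiff.differentiable (by simp)
  have hW := fun v w => hH.integral_fderiv_mul_inner_eq _ hΘ v w
  have hfd : ∀ (t : ℝ) (x v : EuclideanSpace ℝ (Fin 3)), fderiv ℝ (fun x => κ t • g x) x v = κ t * fderiv ℝ g x v := by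
    intro t x v
    have e : (fun x => κ t • g x) = κ t • g := rfl
    rw [e, fderiv_const_smul (hgd x) (κ t)]
    rfl
  simp_rw [hfd] at hW
  have hu : LocallyIntegrableOn (uncurry u) (Iio 0 ×ˢ (univ : Set (EuclideanSpace ℝ (Fin 3)))) volume := by
    simpa only [coe_slab] using hH.locallyIntegrableOn
  have iac : ∀ v w : EuclideanSpace ℝ (Fin 3),
      Integrable (fun z : ℝ × EuclideanSpace ℝ (Fin 3) => κ z.1 * fderiv ℝ g z.2 v * ⟪u z.1 z.2, w⟫)
        (volume : Measure (ℝ × EuclideanSpace ℝ (Fin 3))) := by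
    intro v w
    have hΦ : Continuous fun x => fderiv ℝ g x v • w :=
      ((hg.contDiff.continuous_fderiv (by simp)).clm_apply continuous_const).smul continuous_const
    have hΦc : HasCompactSupport fun x => fderiv ℝ g x v • w :=
      (hg.hasCompactSupport.fderiv_apply (𝕜 := ℝ) v).smul_right (f' := fun _ : EuclideanSpace ℝ (Fin 3) => w)
    have h1 := AntiMember.integrable_mul_inner_field hu hκ hκc hκT hΦ hΦc
    refine h1.congr (Eventually.of_forall fun z => ?_)
    simp only [real_inner_smul_right]
    ring
  have e1 : ∫ z : ℝ × EuclideanSpace ℝ (Fin 3), κ z.1 * ⟪u z.1 z.2, fderiv ℝ g z.2 a • c' - fderiv ℝ g z.2 c' • a⟫ =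
      (∫ z : ℝ × EuclideanSpace ℝ (Fin 3), κ z.1 * fderiv ℝ g z.2 a * ⟪u z.1 z.2, c'⟫) -
        ∫ z : ℝ × EuclideanSpace ℝ (Fin 3), κ z.1 * fderiv ℝ g z.2 c' * ⟪u z.1 z.2, a⟫ := by
    rw [← integral_sub (iac a c') (iac c' a)]
    refine integral_congr_ae (Eventually.of_forall fun z => ?_)
    simp only [inner_sub_right, real_inner_smul_right]
    ring
  have e2 : ∀ v w : EuclideanSpace ℝ (Fin 3),
      ∫ z : ℝ × EuclideanSpace ℝ (Fin 3), κ z.1 * fderiv ℝ g z.2 v * ⟪u z.1 z.2, w⟫ = -∫ t, ∫ x, κ t * g x * ⟪H t x v, w⟫ := by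
    intro v w
    have h1 := iac v w
    rw [Measure.volume_eq_prod] at h1
    rw [Measure.volume_eq_prod, integral_prod _ h1]
    exact hW v w
  rw [e1, e2 a c', e2 c' a]
  -- split the right-hand side (inner integrals split for a.e. `t`)
  have hGl : LocallyIntegrableOn (uncurry H) (Iio 0 ×ˢ (univ : Set (EuclideanSpace ℝ (Fin 3)))) volume := by
    simpa only [coe_slab] using hH.locallyIntegrableOn_grad
  have hC : IsCompact (tsupport κ ×ˢ tsupport g) := hκc.prod hg.hasCompactSupport
  have hCQ : tsupport κ ×ˢ tsupport g ⊆ ((slab (EuclideanSpace ℝ (Fin 3)) (Iio 0) isOpen_Iio :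
      Opens (ℝ × EuclideanSpace ℝ (Fin 3))) : Set (ℝ × EuclideanSpace ℝ (Fin 3))) := by
    rw [coe_slab]; exact prod_mono hκT (subset_univ _)
  have hI : ∀ v w : EuclideanSpace ℝ (Fin 3), Integrable (fun z : ℝ × EuclideanSpace ℝ (Fin 3) => (κ z.1 * g z.2) * ⟪H z.1 z.2 v, w⟫)
      ((volume : Measure ℝ).prod (volume : Measure (EuclideanSpace ℝ (Fin 3)))) := by
    intro v w
    have h2 := integrable_mul_inner_apply_of_locallyIntegrableOn (Q := slab (EuclideanSpace ℝ (Fin 3)) (Iio 0) isOpen_Iio)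
      (by simpa only [coe_slab] using hGl) (θ := fun z : ℝ × EuclideanSpace ℝ (Fin 3) => κ z.1 * g z.2)
      ((hκ.comp continuous_fst).mul (hg.contDiff.continuous.comp continuous_snd)) hC hCQ ?_ v w
    · rwa [Measure.volume_eq_prod] at h2
    · intro z hz
      rcases not_and_or.1 (fun h => hz (mem_prod.2 h)) with h | h
      · simp [image_eq_zero_of_notMem_tsupport h]
      · simp [image_eq_zero_of_notMem_tsupport h]
  have iH : ∀ v w : EuclideanSpace ℝ (Fin 3), Integrable (fun t => ∫ x, κ t * g x * ⟪H t x v, w⟫) (volume : Measure ℝ) :=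
    fun v w => (hI v w).integral_prod_left
  have e3 : ∫ t, ∫ x, κ t * g x * (⟪H t x a, c'⟫ - ⟪H t x c', a⟫) =
      (∫ t, ∫ x, κ t * g x * ⟪H t x a, c'⟫) - ∫ t, ∫ x, κ t * g x * ⟪H t x c', a⟫ := by
    rw [← integral_sub (iH a c') (iH c' a)]
    refine integral_congr_ae ?_
    filter_upwards [(hI a c').prod_right_ae, (hI c' a).prod_right_ae] with t h1 h2
    rw [← integral_sub h1 h2]
    refine integral_congr_ae (Eventually.of_forall fun x => ?_)
    ring
  rw [e3]
  ring

/-- `∫ t θ''(t) dt = 0` for a smooth compactly supported `θ` (integration by parts onto `∫ θ' = 0`). [folklore] -/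
theorem integral_id_mul_deriv_deriv_eq_zero {θ : ℝ → ℝ} (hθ : ContDiff ℝ ∞ θ) (hθc : HasCompactSupport θ) :
    ∫ t, t * deriv (deriv θ) t = 0 := by
  have hθ' : ContDiff ℝ ∞ (deriv θ) := hθ.deriv'
  -- a window containing the support of `θ'`
  obtain ⟨R₀, hR₀⟩ := (hθc.deriv.isCompact : IsCompact (tsupport (deriv θ))).isBounded.subset_closedBall (0 : ℝ)
  set R : ℝ := max R₀ 0 with hRdef
  have hR : tsupport (deriv θ) ⊆ closedBall (0 : ℝ) R := hR₀.trans (closedBall_subset_closedBall (le_max_left _ _))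
  have hR0 : 0 ≤ R := le_max_right _ _
  have hsub : tsupport (deriv θ) ⊆ Ioo (-(R + 1)) (R + 1) := by
    intro t ht
    have h := hR ht
    rw [Metric.mem_closedBall, Real.dist_eq, sub_zero, abs_le] at h
    exact ⟨by linarith [h.1], by linarith [h.2]⟩
  have hab : -(R + 1) < R + 1 := by linarith
  -- the whole-line integral is the window integral, then integration by parts
  have hvan : ∀ t : ℝ, t ∉ Ioo (-(R + 1)) (R + 1) → t * deriv (deriv θ) t = 0 := by
    intro t ht
    have h : t ∉ tsupport (deriv (deriv θ)) := fun h => ht (hsub (tsupport_deriv_subset h))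
    rw [image_eq_zero_of_notMem_tsupport h, mul_zero]
  rw [← setIntegral_eq_integral_of_forall_compl_eq_zero hvan]
  have e1 : (fun t => t * deriv (deriv θ) t) = fun t => deriv (deriv θ) t * t := funext fun t => mul_comm _ _
  rw [e1, DistAffine.setIntegral_deriv_mul_id hab hθ' hsub,
    Elgindi.integral_deriv_eq_zero_of_hasCompactSupport (hθ.of_le (by norm_cast)) hθc, neg_zero]

end AffineCurl

/-! ## Member level -/

/-- **VORTICITY AFFINE IN TIME IN `𝒟'` ⇒ TRIVIAL** (member level, every `ρ > 0`, no regularity beyond the class, no ansatz).  Crux hypotheses verbatim, `T₁ ≤ 0`,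
and `∫∫ θ''(t) ⟪u(t,x), (∂ₐg)(x)c − (∂_c g)(x)a⟫ = 0` for all `θ ∈ C_c^∞((−∞,T₁))`, scalar tests `g`, vectors `a, c` (`∂ₜ²ω = 0` in `𝒟'`).  Then `u = 0`
a.e.: by the momentum identity tested with `θ'(t)η(x)`, `η` the curl pair, the velocity-tested advection is steady in `𝒟'`, and
`Loc.ae_eq_zero_of_frozenLambCurlPast` applies. [folklore; MajdaBertozziCUP2002 §2.4] -/
theorem Loc.ae_eq_zero_of_distributionallyAffineVorticityPast {ρ : ℝ} (hρ : 0 < ρ)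
    {u : ℝ → EuclideanSpace ℝ (Fin 3) → EuclideanSpace ℝ (Fin 3)} {p : ℝ → EuclideanSpace ℝ (Fin 3) → ℝ}
    {H : ℝ → EuclideanSpace ℝ (Fin 3) → EuclideanSpace ℝ (Fin 3) →L[ℝ] EuclideanSpace ℝ (Fin 3)} {c : ℝ≥0}
    (hsw : IsSuitableWeakSolutionOn (slab (EuclideanSpace ℝ (Fin 3)) (Iio 0) isOpen_Iio) 0 0 u p)
    (hH : HasWeakSpatialGradientOn (slab (EuclideanSpace ℝ (Fin 3)) (Iio 0) isOpen_Iio) u H)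
    (hc : ∀ a : ℝ, 0 < a → ENNReal.ofReal (a ^ (2 * ρ)) * cknA a (0 : ℝ × EuclideanSpace ℝ (Fin 3)) u +
        ENNReal.ofReal (a ^ ρ) * cknE a (0 : ℝ × EuclideanSpace ℝ (Fin 3)) H +
        ENNReal.ofReal (a ^ (2 * ρ)) * cknD a (0 : ℝ × EuclideanSpace ℝ (Fin 3)) p ≤ (c : ℝ≥0∞))
    {T₁ : ℝ} (hT₁ : T₁ ≤ 0)
    (hvort : ∀ θ : ℝ → ℝ, ContDiff ℝ ∞ θ → HasCompactSupport θ → tsupport θ ⊆ Iio T₁ →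
      ∀ g : EuclideanSpace ℝ (Fin 3) → ℝ, IsTestFunctionOn (⊤ : Opens (EuclideanSpace ℝ (Fin 3))) g → ∀ a b : EuclideanSpace ℝ (Fin 3),
        ∫ z : ℝ × EuclideanSpace ℝ (Fin 3), deriv (deriv θ) z.1 * ⟪u z.1 z.2, fderiv ℝ g z.2 a • b - fderiv ℝ g z.2 b • a⟫ = 0) :
    uncurry u =ᵐ[volume.restrict (Iio (0 : ℝ) ×ˢ (univ : Set (EuclideanSpace ℝ (Fin 3))))] 0 := by
  have hdist := hsw.distributional
  refine Loc.ae_eq_zero_of_frozenLambCurlPast hρ hsw hH hc hT₁ fun θ hθ hθc hθT g hg a b => ?_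
  -- the momentum identity tested with `θ'(t) η(x)`, `η` the (divergence-free) curl pair
  have hη := isTestFunctionOn_curlPair hg a b
  have hdiv := isDivFree_curlPair_of_contDiff (hg.contDiff.of_le (by norm_cast)) a b
  have hθT0 : tsupport θ ⊆ Iio 0 := hθT.trans (Iio_subset_Iio hT₁)
  obtain ⟨hκ, hκc, hκT⟩ := AntiMember.deriv_cutoff_props hθ hθc hθT0
  have hθ' : ContDiff ℝ ∞ (deriv θ) := hθ.deriv'
  have H1 := AntiMember.momentum_tensor hdist hθ' hκc hκT hη hdiv
  have H2 := hvort θ hθ hθc hθT g hg a b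
  obtain ⟨hκ2, hκ2c, hκ2T⟩ := AntiMember.deriv_cutoff_props hθ' hκc hκT
  have hu : LocallyIntegrableOn (uncurry u) (Iio 0 ×ˢ (univ : Set (EuclideanSpace ℝ (Fin 3)))) volume := by
    simpa only [coe_slab] using hdist.1
  have hum : AEStronglyMeasurable (uncurry u) (volume.restrict (Iio (0 : ℝ) ×ˢ (univ : Set (EuclideanSpace ℝ (Fin 3))))) :=
    hu.aestronglyMeasurable
  have hu2 : LocallyIntegrableOn (fun z => ‖uncurry u z‖ ^ 2) (Iio (0 : ℝ) ×ˢ (univ : Set (EuclideanSpace ℝ (Fin 3)))) volume := by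
    simpa only [coe_slab] using hdist.2.1
  have iA := AntiMember.integrable_mul_inner_field hu hκ2 hκ2c hκ2T hη.contDiff.continuous hη.hasCompactSupport
  have iB := AntiMember.integrable_mul_inner_fderiv_apply hum hu2 hκ hκc hκT (hη.contDiff.of_le (by norm_cast)) hη.hasCompactSupport
  rw [integral_add iA iB, H2, zero_add] at H1
  exact H1

/-- **AFFINE ANTISYMMETRIC PART OF THE WEAK GRADIENT IN `𝒟'` ⇒ TRIVIAL**: the same with the hypothesis on `H`:
`∫ dt ∫ dx θ''(t) g(x) (⟪H(t,x) a, c⟫ − ⟪H(t,x) c, a⟫) = 0` for all `θ ∈ C_c^∞((−∞,T₁))`, tests `g`, vectors `a, c` (`∂ₜ²(H − Hᵀ) = 0` in `𝒟'`). [folklore] -/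
theorem Loc.ae_eq_zero_of_affineWeakGradientCurl {ρ : ℝ} (hρ : 0 < ρ)
    {u : ℝ → EuclideanSpace ℝ (Fin 3) → EuclideanSpace ℝ (Fin 3)} {p : ℝ → EuclideanSpace ℝ (Fin 3) → ℝ}
    {H : ℝ → EuclideanSpace ℝ (Fin 3) → EuclideanSpace ℝ (Fin 3) →L[ℝ] EuclideanSpace ℝ (Fin 3)} {c : ℝ≥0}
    (hsw : IsSuitableWeakSolutionOn (slab (EuclideanSpace ℝ (Fin 3)) (Iio 0) isOpen_Iio) 0 0 u p)
    (hH : HasWeakSpatialGradientOn (slab (EuclideanSpace ℝ (Fin 3)) (Iio 0) isOpen_Iio) u H)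
    (hc : ∀ a : ℝ, 0 < a → ENNReal.ofReal (a ^ (2 * ρ)) * cknA a (0 : ℝ × EuclideanSpace ℝ (Fin 3)) u +
        ENNReal.ofReal (a ^ ρ) * cknE a (0 : ℝ × EuclideanSpace ℝ (Fin 3)) H +
        ENNReal.ofReal (a ^ (2 * ρ)) * cknD a (0 : ℝ × EuclideanSpace ℝ (Fin 3)) p ≤ (c : ℝ≥0∞))
    {T₁ : ℝ} (hT₁ : T₁ ≤ 0)
    (haff : ∀ θ : ℝ → ℝ, ContDiff ℝ ∞ θ → HasCompactSupport θ → tsupport θ ⊆ Iio T₁ →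
      ∀ g : EuclideanSpace ℝ (Fin 3) → ℝ, IsTestFunctionOn (⊤ : Opens (EuclideanSpace ℝ (Fin 3))) g → ∀ a c : EuclideanSpace ℝ (Fin 3),
        ∫ t, ∫ x, deriv (deriv θ) t * g x * (⟪H t x a, c⟫ - ⟪H t x c, a⟫) = 0) :
    uncurry u =ᵐ[volume.restrict (Iio (0 : ℝ) ×ˢ (univ : Set (EuclideanSpace ℝ (Fin 3))))] 0 := by
  refine Loc.ae_eq_zero_of_distributionallyAffineVorticityPast hρ hsw hH hc hT₁ fun θ hθ hθc hθT g hg a c' => ?_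
  have hθT0 : tsupport θ ⊆ Iio 0 := hθT.trans (Iio_subset_Iio hT₁)
  have hθ' : ContDiff ℝ ∞ (deriv θ) := hθ.deriv'
  obtain ⟨-, hκc, hκT⟩ := AntiMember.deriv_cutoff_props hθ hθc hθT0
  obtain ⟨-, hκ2c, hκ2T⟩ := AntiMember.deriv_cutoff_props hθ' hκc hκT
  rw [AffineCurl.integral_mul_inner_curlPair_eq hH hθ'.deriv' hκ2c hκ2T hg a c', haff θ hθ hθc hθT g hg a c', neg_zero]

/-- **VORTICITY AFFINE IN TIME, A.E. FORM ⇒ TRIVIAL.**  If the antisymmetric part of the weak gradient is, a.e. on the past slab `(−∞,T₁) × ℝ³`, an AFFINE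
function of time with locally integrable coefficients `W₀, W₁ : ℝ³ → (ℝ³ →L ℝ³)` —
`⟪H(t,x)a, c⟫ − ⟪H(t,x)c, a⟫ = (⟪W₀(x)a, c⟫ − ⟪W₀(x)c, a⟫) + t (⟪W₁(x)a, c⟫ − ⟪W₁(x)c, a⟫)` for a.e. `(t,x)`, all `a, c` («`ω = ω₀ + t ω₁`») — then the
member is trivial (slicing/Fubini, `∫ θ'' = 0`, `∫ t θ''(t) dt = 0`).  `W₁ = 0`: hand g3's frozen weak vorticity. [folklore] -/
theorem Loc.ae_eq_zero_of_aeAffineWeakVorticity {ρ : ℝ} (hρ : 0 < ρ)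
    {u : ℝ → EuclideanSpace ℝ (Fin 3) → EuclideanSpace ℝ (Fin 3)} {p : ℝ → EuclideanSpace ℝ (Fin 3) → ℝ}
    {H : ℝ → EuclideanSpace ℝ (Fin 3) → EuclideanSpace ℝ (Fin 3) →L[ℝ] EuclideanSpace ℝ (Fin 3)} {c : ℝ≥0}
    (hsw : IsSuitableWeakSolutionOn (slab (EuclideanSpace ℝ (Fin 3)) (Iio 0) isOpen_Iio) 0 0 u p)
    (hH : HasWeakSpatialGradientOn (slab (EuclideanSpace ℝ (Fin 3)) (Iio 0) isOpen_Iio) u H)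
    (hc : ∀ a : ℝ, 0 < a → ENNReal.ofReal (a ^ (2 * ρ)) * cknA a (0 : ℝ × EuclideanSpace ℝ (Fin 3)) u +
        ENNReal.ofReal (a ^ ρ) * cknE a (0 : ℝ × EuclideanSpace ℝ (Fin 3)) H +
        ENNReal.ofReal (a ^ (2 * ρ)) * cknD a (0 : ℝ × EuclideanSpace ℝ (Fin 3)) p ≤ (c : ℝ≥0∞))
    {T₁ : ℝ} (hT₁ : T₁ ≤ 0) {W₀ W₁ : EuclideanSpace ℝ (Fin 3) → EuclideanSpace ℝ (Fin 3) →L[ℝ] EuclideanSpace ℝ (Fin 3)}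
    (hW₀ : LocallyIntegrable W₀ volume) (hW₁ : LocallyIntegrable W₁ volume)
    (haff : ∀ᵐ z ∂(volume.restrict (Iio T₁ ×ˢ (univ : Set (EuclideanSpace ℝ (Fin 3))))), ∀ a b : EuclideanSpace ℝ (Fin 3),
      ⟪H z.1 z.2 a, b⟫ - ⟪H z.1 z.2 b, a⟫ = (⟪W₀ z.2 a, b⟫ - ⟪W₀ z.2 b, a⟫) + z.1 * (⟪W₁ z.2 a, b⟫ - ⟪W₁ z.2 b, a⟫)) :
    uncurry u =ᵐ[volume.restrict (Iio (0 : ℝ) ×ˢ (univ : Set (EuclideanSpace ℝ (Fin 3))))] 0 := by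
  refine Loc.ae_eq_zero_of_affineWeakGradientCurl hρ hsw hH hc hT₁ fun θ hθ hθc hθT g hg a c' => ?_
  -- slices of the a.e. hypothesis
  have e : (volume.restrict (Iio T₁ ×ˢ (univ : Set (EuclideanSpace ℝ (Fin 3)))) : Measure (ℝ × EuclideanSpace ℝ (Fin 3))) =
      ((volume : Measure ℝ).restrict (Iio T₁)).prod (volume : Measure (EuclideanSpace ℝ (Fin 3))) := by
    rw [Measure.volume_eq_prod, ← Measure.restrict_univ (μ := (volume : Measure (EuclideanSpace ℝ (Fin 3)))),
      Measure.prod_restrict, Measure.restrict_univ]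
  rw [e] at haff
  have hsl := Measure.ae_ae_of_ae_prod haff
  -- the pairings of the two coefficient fields with `g`
  have hint : ∀ W : EuclideanSpace ℝ (Fin 3) → EuclideanSpace ℝ (Fin 3) →L[ℝ] EuclideanSpace ℝ (Fin 3), LocallyIntegrable W volume →
      Integrable (fun x => g x * (⟪W x a, c'⟫ - ⟪W x c', a⟫)) volume := by
    intro W hW
    have hF : LocallyIntegrable (fun x => ⟪W x a, c'⟫ - ⟪W x c', a⟫) volume := by
      have h1 : Continuous fun L : EuclideanSpace ℝ (Fin 3) →L[ℝ] EuclideanSpace ℝ (Fin 3) => ⟪L a, c'⟫ - ⟪L c', a⟫ := by fun_prop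
      have hlin : LocallyIntegrable (fun x => (fun L : EuclideanSpace ℝ (Fin 3) →L[ℝ] EuclideanSpace ℝ (Fin 3) => ⟪L a, c'⟫ - ⟪L c', a⟫) (W x))
          volume := by
        set Λ : (EuclideanSpace ℝ (Fin 3) →L[ℝ] EuclideanSpace ℝ (Fin 3)) →L[ℝ] ℝ :=
          (innerSL ℝ c').comp (ContinuousLinearMap.apply ℝ (EuclideanSpace ℝ (Fin 3)) a) -
            (innerSL ℝ a).comp (ContinuousLinearMap.apply ℝ (EuclideanSpace ℝ (Fin 3)) c') with hΛ
        have h2 : (fun x => ⟪W x a, c'⟫ - ⟪W x c', a⟫) = fun x => Λ (W x) := by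
          funext x
          simp [hΛ, innerSL_apply_apply, real_inner_comm]
        have h3 := Λ.locallyIntegrableOn_comp (locallyIntegrableOn_univ.2 hW)
        rw [locallyIntegrableOn_univ] at h3
        rw [h2]
        simpa only [Function.comp_def] using h3
      exact hlin
    exact hF.integrable_smul_left_of_hasCompactSupport hg.contDiff.continuous hg.hasCompactSupport
  set C₀ : ℝ := ∫ x, g x * (⟪W₀ x a, c'⟫ - ⟪W₀ x c', a⟫) with hC₀
  set C₁ : ℝ := ∫ x, g x * (⟪W₁ x a, c'⟫ - ⟪W₁ x c', a⟫) with hC₁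
  have hpt : ∀ᵐ t ∂(volume : Measure ℝ),
      ∫ x, deriv (deriv θ) t * g x * (⟪H t x a, c'⟫ - ⟪H t x c', a⟫) = deriv (deriv θ) t * C₀ + (t * deriv (deriv θ) t) * C₁ := by
    filter_upwards [ae_imp_of_ae_restrict hsl] with t ht
    by_cases htT : t < T₁
    · have h2 := ht htT
      have e1 : (fun x => deriv (deriv θ) t * g x * (⟪H t x a, c'⟫ - ⟪H t x c', a⟫)) =ᵐ[volume]
          fun x => deriv (deriv θ) t * (g x * (⟪W₀ x a, c'⟫ - ⟪W₀ x c', a⟫)) +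
            (t * deriv (deriv θ) t) * (g x * (⟪W₁ x a, c'⟫ - ⟪W₁ x c', a⟫)) := by
        filter_upwards [h2] with x hx
        rw [mul_assoc, hx a c']
        ring
      rw [integral_congr_ae e1, integral_add ((hint W₀ hW₀).const_mul _) ((hint W₁ hW₁).const_mul _),
        integral_const_mul, integral_const_mul]
    · rw [AntiMember.deriv_eq_zero_of_tsupport_subset_Iio (tsupport_deriv_subset.trans hθT) (not_lt.1 htT)]
      simp
  have hθ' : ContDiff ℝ ∞ (deriv θ) := hθ.deriv'
  have hθ'' : ContDiff ℝ 1 (deriv θ) := hθ'.of_le (by norm_cast)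
  have i1 : Integrable (fun t => deriv (deriv θ) t * C₀) (volume : Measure ℝ) :=
    ((hθ'.continuous_deriv (by simp)).integrable_of_hasCompactSupport hθc.deriv.deriv).mul_const _
  have i2 : Integrable (fun t => t * deriv (deriv θ) t * C₁) (volume : Measure ℝ) := by
    have h1 : Continuous fun t => t * deriv (deriv θ) t := continuous_id.mul (hθ'.continuous_deriv (by simp))
    have h2 : HasCompactSupport fun t => t * deriv (deriv θ) t := hθc.deriv.deriv.mul_left
    exact (h1.integrable_of_hasCompactSupport h2).mul_const _
  rw [integral_congr_ae hpt, integral_add i1 i2, integral_mul_const, integral_mul_const,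
    Elgindi.integral_deriv_eq_zero_of_hasCompactSupport hθ'' hθc.deriv, AffineCurl.integral_id_mul_deriv_deriv_eq_zero hθ hθc]
  ring

/-! ## Binder language -/

/-- **Binder language: NO MEMBER HAS VORTICITY AFFINE IN TIME (IN `𝒟'`) IN ITS FAR PAST**: for some `T₁ ≤ 0`,
`∫∫ θ''(t)⟪u, (∂ₐg)c − (∂_c g)a⟫ = 0` for all `θ ∈ C_c^∞((−∞,T₁))`, tests `g`, vectors `a, c` ⇒ trivial.  Contains hand g3's
`Birth.nonSelfSimilar_of_frozenWeakVorticity` (`θ'` in place of `θ''`). [folklore] -/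
theorem Birth.nonSelfSimilar_of_distributionallyAffineVorticityPast :
    ∀ ρ : ℝ, 0 < ρ →
      ∀ (u : ℝ → EuclideanSpace ℝ (Fin 3) → EuclideanSpace ℝ (Fin 3)) (p : ℝ → EuclideanSpace ℝ (Fin 3) → ℝ)
        (H : ℝ → EuclideanSpace ℝ (Fin 3) → EuclideanSpace ℝ (Fin 3) →L[ℝ] EuclideanSpace ℝ (Fin 3)) (c : ℝ≥0),
        Birth.InClass ρ u p H c →
          (∃ T₁ : ℝ, T₁ ≤ 0 ∧ ∀ θ : ℝ → ℝ, ContDiff ℝ ∞ θ → HasCompactSupport θ → tsupport θ ⊆ Iio T₁ →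
              ∀ g : EuclideanSpace ℝ (Fin 3) → ℝ, IsTestFunctionOn (⊤ : Opens (EuclideanSpace ℝ (Fin 3))) g → ∀ a b : EuclideanSpace ℝ (Fin 3),
                ∫ z : ℝ × EuclideanSpace ℝ (Fin 3), deriv (deriv θ) z.1 * ⟪u z.1 z.2, fderiv ℝ g z.2 a • b - fderiv ℝ g z.2 b • a⟫ = 0) →
          uncurry u =ᵐ[volume.restrict (Iio (0 : ℝ) ×ˢ (univ : Set (EuclideanSpace ℝ (Fin 3))))] 0 := by
  intro ρ hρ u p H c hcl h
  obtain ⟨T₁, hT₁, hvort⟩ := h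
  exact Loc.ae_eq_zero_of_distributionallyAffineVorticityPast hρ hcl.1 hcl.2.1 hcl.2.2 hT₁ hvort

/-- **Binder language: NO MEMBER HAS VORTICITY AFFINE IN TIME (A.E. FORM) IN ITS FAR PAST**: for some `T₁ ≤ 0` and locally integrable time-independent
`W₀, W₁`, the antisymmetric part of `H(t,x)` equals that of `W₀(x) + t W₁(x)` for a.e. `(t,x) ∈ (−∞,T₁) × ℝ³` («`ω = ω₀ + t ω₁`») ⇒ trivial. [folklore] -/
theorem Birth.nonSelfSimilar_of_aeAffineWeakVorticity :
    ∀ ρ : ℝ, 0 < ρ →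
      ∀ (u : ℝ → EuclideanSpace ℝ (Fin 3) → EuclideanSpace ℝ (Fin 3)) (p : ℝ → EuclideanSpace ℝ (Fin 3) → ℝ)
        (H : ℝ → EuclideanSpace ℝ (Fin 3) → EuclideanSpace ℝ (Fin 3) →L[ℝ] EuclideanSpace ℝ (Fin 3)) (c : ℝ≥0),
        Birth.InClass ρ u p H c →
          (∃ T₁ : ℝ, T₁ ≤ 0 ∧ ∃ W₀ W₁ : EuclideanSpace ℝ (Fin 3) → EuclideanSpace ℝ (Fin 3) →L[ℝ] EuclideanSpace ℝ (Fin 3),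
              LocallyIntegrable W₀ volume ∧ LocallyIntegrable W₁ volume ∧
              ∀ᵐ z ∂(volume.restrict (Iio T₁ ×ˢ (univ : Set (EuclideanSpace ℝ (Fin 3))))), ∀ a b : EuclideanSpace ℝ (Fin 3),
                ⟪H z.1 z.2 a, b⟫ - ⟪H z.1 z.2 b, a⟫ = (⟪W₀ z.2 a, b⟫ - ⟪W₀ z.2 b, a⟫) + z.1 * (⟪W₁ z.2 a, b⟫ - ⟪W₁ z.2 b, a⟫)) →
          uncurry u =ᵐ[volume.restrict (Iio (0 : ℝ) ×ˢ (univ : Set (EuclideanSpace ℝ (Fin 3))))] 0 := by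
  intro ρ hρ u p H c hcl h
  obtain ⟨T₁, hT₁, W₀, W₁, hW₀, hW₁, haff⟩ := h
  exact Loc.ae_eq_zero_of_aeAffineWeakVorticity hρ hcl.1 hcl.2.1 hcl.2.2 hT₁ hW₀ hW₁ haff

end Summit.NavierStokesRegularity.NavierStokesRegularity.Theorems.PowerGaugeEulerLiouville

end
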